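import Summits.SmoothPoincare4.SmoothPoincare4.Theorems.EntropyRungNoncompactShrinkerGapHeatEntFormLSI
import Summits.SmoothPoincare4.SmoothPoincare4.Theorems.EntropyRungNoncompactShrinkerGapHeatWForm
import Summits.SmoothPoincare4.SmoothPoincare4.Theorems.EntropyRungNoncompactShrinkerGapHeatShrinkerCutoff
import Summits.SmoothPoincare4.SmoothPoincare4.Theorems.EntropyRungNoncompactShrinkerGapHeatFlowExistence
import HarnessLib

/-!
# Stub `stub_compactSupportLSI` of line `collapsed-ends-usc` (crux `EntropyRung.NoncompactShrinkerGap`,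
# stmt-SmoothPoincare4-10868, skeleton v13): the compact-support logarithmic Sobolev inequality of the
# shrinker measure, by the Bakry–Émery heat flow on the complete shrinker

The registered stub `stub_compactSupportLSI` (v13; verbatim the v2 signature `Sig.stub_compactSupportLSI` and
the conclusion of the landed U1 `stub_compactSupportLSI_of_lsi`): on a complete connected normalised 4-d
gradient shrinking Ricci soliton `(M, g, f)` (`Ric + Hess f = ½ g`, `R + |∇f|² = f`, closed `g`-balls compact;
the hypothesis `R ≤ C` is not used), every smooth compactly supported `w` with `∫ w² > 0` satisfies Perelman's
`𝒲`-form of the logarithmic Sobolev inequality `log((4π)⁻² ∫ e^{-f}) ≤ 𝒲(g, w, 1)`.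

Assembly of the heat-flow proof (leads c8, c9; every ingredient a landed helper of the line, namespace
`…Theorems.NoncompactShrinkerGapHeat`): `helper_wForm_of_entForm` (the `𝒲`-form from the entropy form, substitution
`v = w e^{f/2}`) ∘ `helper_entFormLSI_of_flow` (entropy form for `v ∈ C_c^∞` from the flow: a-priori chain
`helper_positiveLSI_of_flow` and `c → 0`) ∘ `helper_heatFlowExistence` (the weighted heat flow
`∂ₛρ = Δρ − g⁻¹(df, dρ)` from `c + ψ₀` on the complete shrinker: flat corrector, Lions' very weak solution,
Hörmander hypoellipticity, energy uniqueness, conjugation `ρ = c + e^{f/2 + λs} u`), the last fed with the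
shrinker cut-offs `η_k = ψ(f/(k+1))` (`helper_shrinkerCutoff`) and the coercivity `|∇f|²/4 − Δf/2 + 2 ≥ 1`
(`Δf = 2 − R`, `R ≥ 0` — Zhang 2009).

References: D. Bakry, M. Émery, LNM 1123 (1985); J. A. Carrillo, L. Ni, Comm. Anal. Geom. 17 (2009), Thm. 1.1,
Thm. 3.1, §4; D. Bakry, I. Gentil, M. Ledoux (2014), Prop. 5.7.1; R. Haslhofer, R. Müller, GAFA 21 (2011),
(2.15)–(2.16); Z.-H. Zhang, Proc. AMS 137 (2009).
-/

noncomputable section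

set_option linter.dupNamespace false

open scoped Manifold ContDiff ENNReal NNReal Topology
open MeasureTheory Set Filter
open Literature.Geometry.Lorentzian Literature.Geometry.Riemannian

namespace Summit.SmoothPoincare4.SmoothPoincare4.Theorems.NoncompactShrinkerGapHeat

open Summit.SmoothPoincare4.SmoothPoincare4.Theorems.NoncompactShrinkerGapCarrilloNiClauses

/-- **Stub `stub_compactSupportLSI`** (line `collapsed-ends-usc`, v13; see the module docstring): the
compact-support logarithmic Sobolev inequality of the shrinker measure in Perelman's `𝒲`-form on a complete
connected normalised 4-d gradient shrinker, `log((4π)⁻² ∫ e^{-f}) ≤ 𝒲(g, w, 1)` for `w ∈ C_c^∞`, `∫ w² > 0`.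
[cite: CarrilloNi2009, Thm. 1.1 and Thm. 3.1] [cite: BakryGentilLedoux2014, Prop. 5.7.1]
[cite: HaslhoferMuller2011, (2.15)–(2.16)] -/
theorem stub_compactSupportLSI : ∀ (M : Type) [TopologicalSpace M] [T2Space M] [SecondCountableTopology M] [ChartedSpace (EuclideanSpace ℝ (Fin 4)) M] [IsManifold (𝓡 4) ∞ M] [ConnectedSpace M] [T3Space M] [MeasurableSpace M] [BorelSpace M] (g : PseudoRiemannianMetric (𝓡 4) ∞ (EuclideanSpace ℝ (Fin 4)) (TangentSpace (𝓡 4) : M → Type _)) [g.HasLeviCivita] (f : M → ℝ) (hg : g.IsRiemannian), (∀ (x : M) (r : NNReal), IsCompact {y : M | g.edist hg x y ≤ r}) → ContMDiff (𝓡 4) 𝓘(ℝ, ℝ) ∞ f → (∀ (x : M) (X Y : TangentSpace (𝓡 4) x), g.ricci x X Y + g.hessian f x X Y = (1 / 2 : ℝ) * g.val x X Y) → (∀ x : M, g.scalarCurvature x + g.gradSq f x = f x) → (∃ C : ℝ, ∀ x : M, g.scalarCurvature x ≤ C) → ∀ w : M → ℝ, ContMDiff (𝓡 4) 𝓘(ℝ,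 ℝ) ∞ w → HasCompactSupport w → 0 < ∫ x, w x ^ 2 ∂g.riemVolume → Real.log ((4 * Real.pi) ^ (-(4 : ℝ) / 2) * ∫ x, Real.exp (-f x) ∂g.riemVolume) ≤ (∫ x, (g.scalarCurvature x * w x ^ 2 + 4 * g.gradSq w x - w x ^ 2 * Real.log (w x ^ 2)) ∂g.riemVolume) / (∫ x, w x ^ 2 ∂g.riemVolume) + Real.log (∫ x, w x ^ 2 ∂g.riemVolume) - Real.log ((4 * Real.pi) ^ 2) - 4 := by
  intro M _ _ _ _ _ _ _ _ _ g _ f hg hc hf hsol hnorm hbdd w hw hwc hwZ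
  refine helper_wForm_of_entForm M g f hg hc hf hsol hnorm ?_ hbdd w hw hwc hwZ
  refine helper_entFormLSI_of_flow 4 M g f hg hc hf hsol hnorm ?_
  intro c ψ₀ _ hψ hψc T hT
  -- the shrinker cut-offs
  obtain ⟨η, C, hηs, hηc, hη01, hηmono, hη1, -, hηΔ, -⟩ :=
    helper_shrinkerCutoff 4 M g f hg hc hf hsol hnorm
  have hη1' : ∀ x, ∀ᶠ k in atTop, ∀ᶠ y in 𝓝 x, η k y = 1 := fun x ↦ by
    filter_upwards [tendsto_natCast_atTop_atTop.eventually (eventually_gt_atTop (f x))] with k hk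
    exact hη1 k x (by linarith)
  -- coercivity of the conjugated potential: `|∇f|²/4 − Δf/2 + 2 ≥ 1` (`Δf = 2 − R`, `R ≥ 0`)
  obtain ⟨hR0, -, -⟩ := scalarCurvature_nonneg_and_isCompact_sublevel g f hg hc hf hsol hnorm
  have hlam : ∀ x, 1 ≤ g.gradSq f x / 4 - g.dalembertian f x / 2 + 2 := fun x ↦ by
    have h1 := CarrilloNi2009_shrinkerLSI.scalarCurvature_add_dalembertian hsol x
    have h2 := hR0 x
    have h3 := g.gradSq_nonneg hg f x
    norm_num at h1
    linarith
  exact helper_heatFlowExistence 4 M g f 2 hg hf hlam η C hηs hηc hη01 hηmono hη1' hηΔ c ψ₀ hψ hψc T hT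

end Summit.SmoothPoincare4.SmoothPoincare4.Theorems.NoncompactShrinkerGapHeat

end
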